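import Mathlib
import Literature.MathematicalPhysics.QuantumFieldTheory.Balaban1983to89.B5Momentum133

/-!
# `Balaban1983to89.B5Eq135Momentum` — [Balaban1984PropagatorsI] Sect. C p. 24: the momentum form (1.35) of
`‖∂*A − Δλ₀‖²` and the rewriting (1.37) of the exponent of (1.28) — PROVED for the typed torus operators
(theorems only)

statement-level skeleton of published theorems with citation tags; proofs where landed; nothing here is a claim about the Yang–Mills mass gap

CITATION HEADER.  T. Bałaban, *Propagators and renormalization transformations for lattice gauge theories. I*,
Commun. Math. Phys. **95** (1984) 17–40 [Balaban1984PropagatorsI] (= B5; PDF held `paper:balaban1984-cmp95-propagators-rt-i`,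
journal page = PDF page + 16; p. 24 READ AS AN IMAGE on the ×2 render
`run/shared/lean/pub/pub-balaban/b2b-balaban-ref1/pages/1984-cmp95-propagators-rt-I/1984-cmp95-propagators-rt-I-p008-x2.png`,
p. 22 on `…-p006-x2.png`).  Unit `lit-balaban-r02` gen 3 (reader/typer and fold owner of B5; HOME
`run/shared/lean/pub/lit-balaban/`).  SKELETON row **B5.Eq1.36** ((1.35)–(1.37); status before this file:
`proved-existing ((1.36)-type bounds) · absent ((1.35)/(1.37) displays)`).  Everything is stated for the TYPED
position-space objects of the B5 leaves and proved from their landed momentum representations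
(`B5Momentum133.dft_PcT_apply_of_ne` / `dft_PcT_zero_fiber`, `B5Value126.residual_lambda0`); no definition is
introduced.

WHAT IS PRINTED (verbatim, p. 24 [PDF 8]).  *"Substituting it [(1.34)] into the expression in the exponent of (1.24) we
get
‖∂*A − Δλ₀‖² = (2π)^{−d}∫_{T̃_η}dp |(∂*A)~(p) − Δ(p)λ̃₀(p)|²
 = (2π)^{−d}∫_{T̃₁^{(k)}, p′≠0}dp′ Σ_l (|u_k(p′+l)|²/Δ²(p′+l)) (Σ_{l′}|u_k(p′+l′)|²/Δ²(p′+l′))^{−2}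
     ·|Σ_{l′}(u_k(p′+l′)/Δ(p′+l′))(∂*A)~(p′+l′)|²
 = (2π)^{−d}∫_{T̃₁^{(k)}, p′≠0}dp′ (Σ_l |u_k(p′+l)|²/Δ²(p′+l))^{−1} |Σ_l (u_k(p′+l)/Δ(p′+l))(∂*A)~(p′+l)|²,   (1.35)
where ∫_{T̃_η}dp… denotes the sum Σ_{p∈T̃_η}(Π_{μ=1}^{d}(π/L_μ)L^kε)…, similarly ∫_{T̃₁^{(k)}}dp…, and we have used the
decomposition p = p′ + l, writing ∫_{T̃_η}dp… = ∫_{T̃₁^{(k)}}dp′Σ_l…. We have used also the equality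
(∂*A)~(p) = Σ_μ \overline{∂_μ(p)}Ã_μ(p), more exactly its consequence (∂*A)~(0) = 0. […] Let us introduce the unit
lattice operator Δ₀(p′) = Σ_{μ=1}^{d}|e^{ip′_μ} − 1|². […] The expression in the exponent in (1.28) can be written as
(1/2α)(2π)^{−d}∫dp′ Σ_l |(∂*A)~(p′+l) − (\overline{u_k(p′+l)}Δ₀(p′)/Δ(p′+l))
   ·(Σ_{l″}|u_k(p′+l″)|²Δ₀²(p′)/Δ²(p′+l″))^{−1} Σ_{l′}(u_k(p′+l′)Δ₀(p′)/Δ(p′+l′))(∂*A)~(p′+l′)|².   (1.37)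
Now all the expressions above are well defined and bounded even at p′ = 0 if we extend them by continuity. The
expression in |…|² defines the projection operator acting on ∂*A and appearing in (1.27)."*  ((1.28) p. 22:
*"exp[−(1/2α)‖(I − Δ⁻¹Q′_k*(Q′_kΔ⁻²Q′_k*)⁻¹Q′_kΔ⁻¹)∂*A‖²]"*.)

DICTIONARY (the conventions of `B5Momentum130`/`B5Momentum133`, unchanged): `∂*A = b : Tor (fine n M) → ℂ` with
«(∂*A)~(0) = 0» = `Σ_x b x = 0`; `p = p′ + l ↔ pOf n M (k, q)` (`q ↔ p′`, `k ↔ l`); `(∂*A)~ = dft (fine n M) *ᵥ b` (the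
UNITARY discrete Fourier transform — so the printed measures `(2π)^{−d}∫dp`, `∫dp′Σ_l` become plain sums `Σ_p`,
`Σ_q Σ_k` and the two sides of (1.35) carry no volume factors; the weight `η^d` of `‖·‖²` cancels against the
normalisation of the printed transform in the same way); `Δ(p) = lsym (fine n M) c p` (`c` the lattice constant of
`B5Action121.LapS`, `c ≠ 0`), `u_k(p′+l) = uSym n k (sOf M q)`; the two printed sums `Xs n M c q = Σ_l|u_k|²/Δ²`,
`Bs n M c b q = Σ_l (u_k/Δ)(∂*A)~` of (1.33); `λ₀ = B5Value126.lambda0 n M c b` ((1.26)); `Δ₀(p′) =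
Σ_μ |e^{ip′_μ} − 1|² = Σ_μ ‖B5Prop11Fiber.d1Sym (sOf M q) μ‖²` (`= B4Strip.Delta1r 0 (sOf M q)`); the operator of
(1.28) `I − Δ⁻¹Q′_k*(Q′_kΔ⁻²Q′_k*)⁻¹Q′_kΔ⁻¹ = 1 − B5Value126.PcT n M c`.

WHAT THIS MODULE PROVES.  `sum_norm_sq_dft` (Plancherel for the unitary DFT of `T_η`), `sum_pOf_fibres` (Σ_p = Σ_{p′}Σ_l),
`norm_lsym`, `norm_Xs` (‖Xs‖ = Σ_l|u_k|²/|Δ|², the printed positive sum), `norm_sq_dft_PcT_of_ne` (the fibre `p′ ≠ 0`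
integrand of the middle line of (1.35)), **`eq135_mid`** (the middle equality of (1.35)), **`eq135`** (the final form
of (1.35)), `dft_PcT_eq_bracket137` (for `p′ ≠ 0` the printed Δ₀-inserted bracket of (1.37) IS `(P∂*A)~(p′+l)` — the
Δ₀(p′) factors cancel), **`eq137`** ((1.37): the exponent of (1.28) in momentum form, the fibre `p′ = 0` entering with
the bracket's continuous extension `0`).  Hypotheses: `c ≠ 0`, `Σ_x b x = 0`.  No definitions, no `sorry`; axioms
standard.
-/

open scoped BigOperators Matrix ComplexConjugate ComplexOrder
open Finset Complex Matrix

namespace Literature.MathematicalPhysics.QuantumFieldTheory.Balaban1983to89.B5Eq135Momentum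

open Literature.MathematicalPhysics.QuantumFieldTheory.Balaban1983to89.B4Strip
open Literature.MathematicalPhysics.QuantumFieldTheory.Balaban1983to89.B5Prop11Fiber
open Literature.MathematicalPhysics.QuantumFieldTheory.Balaban1983to89.B5Prop11Leaves
open Literature.MathematicalPhysics.QuantumFieldTheory.Balaban1983to89.B5Prop11Plancherel
open Literature.MathematicalPhysics.QuantumFieldTheory.Balaban1983to89.B5Action121
open Literature.MathematicalPhysics.QuantumFieldTheory.Balaban1983to89.B5Block118
open Literature.MathematicalPhysics.QuantumFieldTheory.Balaban1983to89.B5LaplaceInverse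
open Literature.MathematicalPhysics.QuantumFieldTheory.Balaban1983to89.B5Value126
open Literature.MathematicalPhysics.QuantumFieldTheory.Balaban1983to89.B5Momentum130
open Literature.MathematicalPhysics.QuantumFieldTheory.Balaban1983to89.B5Momentum133

noncomputable section

variable {d : ℕ} (n : ℕ) [NeZero n] (M : Fin d → ℕ) [hM : ∀ μ, NeZero (M μ)] (c : ℂ)

/-! ## §1 Plancherel, the decomposition `p = p′ + l`, and the moduli of the symbols -/

/-- Plancherel for the unitary DFT of the torus `T_η`: `Σ_p |f̃(p)|² = Σ_x |f(x)|²` — the first equality of (1.35)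
(*"‖∂*A − Δλ₀‖² = (2π)^{−d}∫dp|…|²"*). [cite: Balaban1984PropagatorsI, (1.35) p.24] -/
theorem sum_norm_sq_dft (f : Tor (fine n M) → ℂ) :
    ∑ p, ‖(dft (fine n M) *ᵥ f) p‖ ^ 2 = ∑ x, ‖f x‖ ^ 2 := by
  have hU : star (dft (fine n M)) * dft (fine n M) = 1 :=
    Matrix.mem_unitaryGroup_iff'.mp (dft_mem_unitaryGroup (fine n M))
  have key : star (dft (fine n M) *ᵥ f) ⬝ᵥ (dft (fine n M) *ᵥ f) = star f ⬝ᵥ f := by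
    rw [Matrix.star_mulVec, ← Matrix.dotProduct_mulVec, Matrix.mulVec_mulVec,
      ← Matrix.star_eq_conjTranspose, hU, Matrix.one_mulVec]
  have h2 : ∀ g : Tor (fine n M) → ℂ, star g ⬝ᵥ g = ((∑ x, ‖g x‖ ^ 2 : ℝ) : ℂ) := by
    intro g
    simp only [dotProduct, Pi.star_apply, Complex.star_def, Complex.ofReal_sum, Complex.ofReal_pow]
    exact Finset.sum_congr rfl fun i _ => Complex.conj_mul' (g i)
  rw [h2, h2] at key
  exact_mod_cast key

/-- *"we have used the decomposition p = p′ + l, writing ∫_{T̃_η}dp… = ∫_{T̃₁^{(k)}}dp′Σ_l…"*: a sum over the fine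
momenta is the sum over the reduced momenta `p′ ↔ q` of the sums over the offsets `l ↔ k`.
[cite: Balaban1984PropagatorsI, (1.35) p.24] -/
theorem sum_pOf_fibres (g : Tor (fine n M) → ℝ) :
    ∑ p, g p = ∑ q : Tor M, ∑ k : Fin d → Fin n, g (pOf n M (k, q)) := by
  rw [← (pOf_bijective n M).sum_comp g, Fintype.sum_prod_type, Finset.sum_comm]

/-- `|Δ(p)| = Σ_ν|∂_ν(p)|²` (the symbol of `Δ` is a non-negative real). [cite: Balaban1984PropagatorsI, (1.31) p.23] -/
theorem norm_lsym (p : Tor (fine n M)) : ‖lsym (fine n M) c p‖ = ∑ ν, ‖ssym (fine n M) c ν p‖ ^ 2 := by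
  rw [lsym_eq_sum_norm_sq, Complex.norm_real, Real.norm_of_nonneg (Finset.sum_nonneg fun ν _ => by positivity)]

/-- the printed normalising sum is the positive real `|Xs| = Σ_l |u_k(p′+l)|²/|Δ(p′+l)|²`.
[cite: Balaban1984PropagatorsI, (1.33) p.23, (1.35) p.24] -/
theorem norm_Xs (q : Tor M) :
    ‖Xs n M c q‖ = ∑ k : Fin d → Fin n, ‖uSym n k (sOf M q)‖ ^ 2 / ‖lsym (fine n M) c (pOf n M (k, q))‖ ^ 2 := by
  rw [Xs_eq, Complex.norm_real, Real.norm_of_nonneg (Finset.sum_nonneg fun k _ => by positivity)]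
  refine Finset.sum_congr rfl fun k _ => ?_
  rw [norm_lsym]

/-! ## §2 (1.35) -/

/-- the integrand of the middle line of (1.35) on the fibre `p′ ≠ 0`:
`|(∂*A − Δλ₀)~(p′+l)|² = (|u_k(p′+l)|²/Δ²(p′+l))·(Σ_{l′}|u_k|²/Δ²)^{−2}·|Σ_{l′}(u_k/Δ)(∂*A)~|²`
(`(∂*A − Δλ₀)~ = (P∂*A)~`, `B5Momentum133.dft_PcT_apply_of_ne`). [cite: Balaban1984PropagatorsI, (1.35) p.24] -/
theorem norm_sq_dft_PcT_of_ne (hc : c ≠ 0) (b : Tor (fine n M) → ℂ) (k : Fin d → Fin n) {q : Tor M}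
    (hq : q ≠ 0) :
    ‖(dft (fine n M) *ᵥ (PcT n M c *ᵥ b)) (pOf n M (k, q))‖ ^ 2
      = ‖uSym n k (sOf M q)‖ ^ 2 / ‖lsym (fine n M) c (pOf n M (k, q))‖ ^ 2
          * (‖Bs n M c b q‖ ^ 2 / ‖Xs n M c q‖ ^ 2) := by
  rw [dft_PcT_apply_of_ne n M c hc b k hq, norm_mul, norm_mul, norm_div, norm_inv, Complex.norm_conj]
  ring

/-- **(1.35), middle equality** for the typed torus objects (`∂*A = b ⊥ 1`, `c ≠ 0`):
`‖∂*A − Δλ₀‖² = Σ_{p′≠0} Σ_l (|u_k(p′+l)|²/Δ²(p′+l))·(Σ_{l′}|u_k(p′+l′)|²/Δ²(p′+l′))^{−2}·|Σ_{l′}(u_k/Δ)(∂*A)~(p′+l′)|²`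
(unitary DFT: no volume factors; the fibre `p′ = 0` contributes `0` — «its consequence (∂*A)~(0) = 0»).
[cite: Balaban1984PropagatorsI, (1.35) p.24] -/
theorem eq135_mid (hc : c ≠ 0) (b : Tor (fine n M) → ℂ) (hb : ∑ x, b x = 0) :
    ∑ x, ‖(b - LapS (fine n M) c *ᵥ lambda0 n M c b) x‖ ^ 2
      = ∑ q ∈ univ.erase (0 : Tor M), ∑ k : Fin d → Fin n,
          ‖uSym n k (sOf M q)‖ ^ 2 / ‖lsym (fine n M) c (pOf n M (k, q))‖ ^ 2
            * (‖Bs n M c b q‖ ^ 2 / ‖Xs n M c q‖ ^ 2) := by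
  rw [residual_lambda0 n M c hc b hb, ← sum_norm_sq_dft n M (PcT n M c *ᵥ b), sum_pOf_fibres n M,
    ← Finset.add_sum_erase _ _ (Finset.mem_univ (0 : Tor M))]
  have h0 : ∑ k : Fin d → Fin n, ‖(dft (fine n M) *ᵥ (PcT n M c *ᵥ b)) (pOf n M (k, 0))‖ ^ 2 = 0 :=
    Finset.sum_eq_zero fun k _ => by rw [dft_PcT_zero_fiber, norm_zero, zero_pow two_ne_zero]
  rw [h0, zero_add]
  refine Finset.sum_congr rfl fun q hq => Finset.sum_congr rfl fun k _ => ?_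
  exact norm_sq_dft_PcT_of_ne n M c hc b k (Finset.ne_of_mem_erase hq)

/-- **(1.35), final form** for the typed torus objects (`∂*A = b ⊥ 1`, `c ≠ 0`):
`‖∂*A − Δλ₀‖² = Σ_{p′≠0} (Σ_l |u_k(p′+l)|²/Δ²(p′+l))^{−1} |Σ_l (u_k(p′+l)/Δ(p′+l))(∂*A)~(p′+l)|²`.
[cite: Balaban1984PropagatorsI, (1.35) p.24] -/
theorem eq135 (hc : c ≠ 0) (b : Tor (fine n M) → ℂ) (hb : ∑ x, b x = 0) :
    ∑ x, ‖(b - LapS (fine n M) c *ᵥ lambda0 n M c b) x‖ ^ 2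
      = ∑ q ∈ univ.erase (0 : Tor M), ‖Bs n M c b q‖ ^ 2 / ‖Xs n M c q‖ := by
  rw [eq135_mid n M c hc b hb]
  refine Finset.sum_congr rfl fun q hq => ?_
  have hX : ‖Xs n M c q‖ ≠ 0 := norm_ne_zero_iff.mpr (Xs_ne_zero n M c hc (Finset.ne_of_mem_erase hq))
  rw [← Finset.sum_mul, ← norm_Xs]
  field_simp

/-! ## §3 (1.37) -/

/-- On the fibre `p′ ≠ 0` the Δ₀-inserted bracket of (1.37) IS `(P∂*A)~(p′+l)` — the factors `Δ₀(p′)` cancel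
(`Δ₀(p′) = Σ_μ|e^{ip′_μ} − 1|² > 0` for `p′ ≠ 0`):
`(\overline{u_k(p′+l)}Δ₀(p′)/Δ(p′+l))·(Σ_{l″}|u_k(p′+l″)|²Δ₀²(p′)/Δ²(p′+l″))^{−1}·Σ_{l′}(u_k(p′+l′)Δ₀(p′)/Δ(p′+l′))(∂*A)~(p′+l′)
= (P∂*A)~(p′+l)`. [cite: Balaban1984PropagatorsI, (1.37) p.24] -/
theorem dft_PcT_eq_bracket137 (hc : c ≠ 0) (b : Tor (fine n M) → ℂ) (k : Fin d → Fin n) {q : Tor M}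
    (hq : q ≠ 0) :
    (dft (fine n M) *ᵥ (PcT n M c *ᵥ b)) (pOf n M (k, q))
      = conj (uSym n k (sOf M q)) * ((∑ μ, ‖d1Sym (sOf M q) μ‖ ^ 2 : ℝ) : ℂ)
            / lsym (fine n M) c (pOf n M (k, q))
          * (∑ k'' : Fin d → Fin n, ((‖uSym n k'' (sOf M q)‖ ^ 2 : ℝ) : ℂ)
              * ((∑ μ, ‖d1Sym (sOf M q) μ‖ ^ 2 : ℝ) : ℂ) ^ 2 / lsym (fine n M) c (pOf n M (k'', q)) ^ 2)⁻¹
          * ∑ k' : Fin d → Fin n, uSym n k' (sOf M q) * ((∑ μ, ‖d1Sym (sOf M q) μ‖ ^ 2 : ℝ) : ℂ)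
              / lsym (fine n M) c (pOf n M (k', q)) * (dft (fine n M) *ᵥ b) (pOf n M (k', q)) := by
  -- `Δ₀(p′) > 0` on the punctured Brillouin zone
  have hD0 : (((∑ μ, ‖d1Sym (sOf M q) μ‖ ^ 2 : ℝ) : ℂ)) ≠ 0 := by
    have hs : sOf M q ≠ 0 := sOf_ne_zero M hq
    obtain ⟨ν, hν⟩ := Function.ne_iff.mp hs
    have hpos : 0 < Delta1r 0 (sOf M q) := Delta1r_pos (sOf M q) (abs_sOf_le M q) ν hν
    have hD : (∑ μ, ‖d1Sym (sOf M q) μ‖ ^ 2) = Delta1r 0 (sOf M q) := by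
      simp only [Delta1r, add_zero, norm_d1Sym_sq]
    rw [hD]
    exact_mod_cast hpos.ne'
  -- the two printed sums are `Δ₀²·Xs` and `Δ₀·Bs`
  have hX : ∑ k'' : Fin d → Fin n, ((‖uSym n k'' (sOf M q)‖ ^ 2 : ℝ) : ℂ)
        * ((∑ μ, ‖d1Sym (sOf M q) μ‖ ^ 2 : ℝ) : ℂ) ^ 2 / lsym (fine n M) c (pOf n M (k'', q)) ^ 2
      = ((∑ μ, ‖d1Sym (sOf M q) μ‖ ^ 2 : ℝ) : ℂ) ^ 2 * Xs n M c q := by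
    rw [Xs, Finset.mul_sum]
    exact Finset.sum_congr rfl fun k'' _ => by ring
  have hB : ∑ k' : Fin d → Fin n, uSym n k' (sOf M q) * ((∑ μ, ‖d1Sym (sOf M q) μ‖ ^ 2 : ℝ) : ℂ)
        / lsym (fine n M) c (pOf n M (k', q)) * (dft (fine n M) *ᵥ b) (pOf n M (k', q))
      = ((∑ μ, ‖d1Sym (sOf M q) μ‖ ^ 2 : ℝ) : ℂ) * Bs n M c b q := by
    rw [Bs, Finset.mul_sum]
    exact Finset.sum_congr rfl fun k' _ => by ring
  rw [hX, hB, dft_PcT_apply_of_ne n M c hc b k hq]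
  have hXs : Xs n M c q ≠ 0 := Xs_ne_zero n M c hc hq
  field_simp

/-- **(1.37)** for the typed torus objects (`∂*A = b ⊥ 1`, `c ≠ 0`, any `α`): the exponent of (1.28),
`(1/2α)‖(I − Δ⁻¹Q′_k*(Q′_kΔ⁻²Q′_k*)⁻¹Q′_kΔ⁻¹)∂*A‖² = (1/2α)Σ_x|((1 − P)b)(x)|²`, equals
`(1/2α)Σ_{p′}Σ_l |(∂*A)~(p′+l) − [the Δ₀-inserted bracket]|²`, the bracket taken with its continuous extension `0` on the
fibre `p′ = 0` (*"all the expressions above are well defined and bounded even at p′ = 0 if we extend them by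
continuity"*; on the torus `(P∂*A)~` vanishes there, `B5Momentum133.dft_PcT_zero_fiber`).
[cite: Balaban1984PropagatorsI, (1.37) p.24, (1.28) p.22] -/
theorem eq137 (hc : c ≠ 0) (b : Tor (fine n M) → ℂ) (α : ℝ) :
    1 / (2 * α) * ∑ x, ‖((1 - PcT n M c) *ᵥ b) x‖ ^ 2
      = 1 / (2 * α) * ∑ q : Tor M, ∑ k : Fin d → Fin n,
          ‖(dft (fine n M) *ᵥ b) (pOf n M (k, q))
            - (if q = 0 then 0 else
                conj (uSym n k (sOf M q)) * ((∑ μ, ‖d1Sym (sOf M q) μ‖ ^ 2 : ℝ) : ℂ)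
                    / lsym (fine n M) c (pOf n M (k, q))
                  * (∑ k'' : Fin d → Fin n, ((‖uSym n k'' (sOf M q)‖ ^ 2 : ℝ) : ℂ)
                      * ((∑ μ, ‖d1Sym (sOf M q) μ‖ ^ 2 : ℝ) : ℂ) ^ 2 / lsym (fine n M) c (pOf n M (k'', q)) ^ 2)⁻¹
                  * ∑ k' : Fin d → Fin n, uSym n k' (sOf M q) * ((∑ μ, ‖d1Sym (sOf M q) μ‖ ^ 2 : ℝ) : ℂ)
                      / lsym (fine n M) c (pOf n M (k', q)) * (dft (fine n M) *ᵥ b) (pOf n M (k', q)))‖ ^ 2 := by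
  congr 1
  rw [← sum_norm_sq_dft n M ((1 - PcT n M c) *ᵥ b), sum_pOf_fibres n M]
  refine Finset.sum_congr rfl fun q _ => Finset.sum_congr rfl fun k _ => ?_
  have hsplit : (dft (fine n M) *ᵥ ((1 - PcT n M c) *ᵥ b)) (pOf n M (k, q))
      = (dft (fine n M) *ᵥ b) (pOf n M (k, q)) - (dft (fine n M) *ᵥ (PcT n M c *ᵥ b)) (pOf n M (k, q)) := by
    rw [Matrix.sub_mulVec, Matrix.one_mulVec, Matrix.mulVec_sub, Pi.sub_apply]
  rw [hsplit]
  by_cases hq : q = 0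
  · subst hq
    rw [if_pos rfl, dft_PcT_zero_fiber]
  · rw [if_neg hq, dft_PcT_eq_bracket137 n M c hc b k hq]

end

end Literature.MathematicalPhysics.QuantumFieldTheory.Balaban1983to89.B5Eq135Momentum
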